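import Summits.RiemannHypothesis.RiemannHypothesis.Theorems.GroundBartaEvenWinsBeyondArchDeflationBound
import Summits.RiemannHypothesis.RiemannHypothesis.Theorems.GroundBartaEvenWinsBeyondArchDeflationWindowImageRepr
import Summits.RiemannHypothesis.RiemannHypothesis.Theorems.GroundBartaEvenWinsBeyondArchDeflationTrialEnergy
import HarnessLib

/-!
# RiemannHypothesis / GroundBarta — rung 4 (`EvenWinsBeyondArch`, stmt-RiemannHypothesis-18807):
# the deflated Temple (Lehmann–Maehly) L-side programme, IX — the bound from polynomial × indicator Ritz data

Helper file (`--supports stmt-RiemannHypothesis-18807`), RH-free, Mathlib + landed tree files only, no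
definitions, no named facts.

THE CERTIFICATE-FACING FORM of the deflated Temple L-side (A's HANDOFF §farm G1–G3, analytic part complete):
all form-domain hypotheses of `dt_weil{Even,Odd}GroundEnergy_ge_of_deflation` (file IV) are DISCHARGED for trial
vectors `v_i = g_i · 𝟙_{[-c,c]}` with `g_i ∈ C²(ℝ)` of the sector's parity (e.g. even / odd polynomials — the
Legendre Ritz vectors of FEASIBILITY-234): `v_i` lies in the sector form domain (file VIII), its window image is
the EXPLICIT function

  `F_i(y) = 𝟙_{[-c,c]}(y) · [ 2(∫v_i ch) ch(y/2) − 2(∫v_i sh) sh(y/2)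
              + Σ_{log n < 2c} Λ(n) n^{-1/2} (2v_i(y) − v_i(y − log n) − v_i(y + log n))
              + ∫₀^∞ ρ(t) (2v_i(y) − v_i(y−t) − v_i(y+t)) dt ]  −  M_c v_i(y)`

(files V–VII: `F_i ∈ L²` and `E_c(v_i, f) = ⟨F_i, f⟩` on the window form domain).  What remains for a
certificate at a window `c` is FINITE DATA: a low-precision moment certificate
`β ∫|φ|² ≤ Re Q(φ) + Σ μ_i |∫ φ v̄_i|²` on smooth sector tests (`μ_i ≥ 0`), a residual coefficient matrix `W`,
`λ < β`, and the positive semidefiniteness of the `k × k` matrix `(β − λ)(A − λG) − R` whose entries are explicit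
one- and two-dimensional integrals of the `g_i` (`A_ij = E_c(v_i, v_j)`, `G_ij = ⟨v_i, v_j⟩`,
`R_ij = ⟨F_i − Σ W_il v_l, F_j − Σ W_jl v_l⟩`).  Conclusion: `λ ≤ ε_ev(c)` (`dt_weilEvenGroundEnergy_ge_of_ritz`),
`λ ≤ ε_od(c)` (`dt_weilOddGroundEnergy_ge_of_ritz`).  Prover B, speedrun unit `sr-gb-rung-b` (gen 3).

References: A. Weinstein, W. Stenger, *Methods of Intermediate Problems for Eigenvalues* (1972) Ch. 5 §9;
E. Bombieri, Rend. Mat. Acc. Lincei (9) 11 (2000) 183–233, Thm 2, §4 Lemma 1; H. Yoshida, Adv. Stud. Pure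
Math. 21 (1992) Thm 1 (the moment certificates supplying `β`).
-/

set_option linter.dupNamespace false

noncomputable section

open MeasureTheory Set Filter
open scoped Topology ENNReal NNReal ComplexConjugate BigOperators

namespace Summit.RiemannHypothesis.RiemannHypothesis.Theorems.EvenWinsBeyondArch

open Literature.NumberTheory.LFunctions
open Summit.RiemannHypothesis.RiemannHypothesis.Theorems.OddSector (weilDirichletEnergy₂ weilPoleForm₂)

/-- **The deflated Temple bound from `C²` × indicator Ritz data, parity `σ`** (`σ = ±1` in use).  See the module docstring;
this is the master statement behind the even / odd corollaries. -/
theorem dt_sector_bound_of_ritz {c : ℝ} (hc : 0 < c) (σ : ℝ) {k : ℕ}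
    (g : Fin k → ℝ → ℝ) (hg : ∀ i, ContDiff ℝ 2 (g i)) (hgp : ∀ i x, g i (-x) = σ * g i x)
    (v F : Fin k → ℝ → ℂ) (hv : ∀ i x, v i x = (((Icc (-c) c).indicator (g i) x : ℝ) : ℂ))
    (hF : ∀ i y, F i y = (Icc (-c) c).indicator (fun y ↦
        2 * (∫ x, v i x * (Real.cosh (x / 2) : ℂ)) * (Real.cosh (y / 2) : ℂ) -
          2 * (∫ x, v i x * (Real.sinh (x / 2) : ℂ)) * (Real.sinh (y / 2) : ℂ) +
        (∑ n ∈ weilPrimeIndex c, (((ArithmeticFunction.vonMangoldt n : ℝ) / Real.sqrt n : ℝ) : ℂ) *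
          (2 * v i y - v i (y - Real.log n) - v i (y + Real.log n))) +
        ∫ t in Ioi 0, (weilArchDensity t : ℂ) * (2 * v i y - v i (y - t) - v i (y + t))) y -
      (weilMarkovConstant c : ℂ) * v i y)
    (W : Fin k → Fin k → ℝ) (μ : Fin k → ℝ) {β lam : ℝ} (hlam : lam < β) (hμ : ∀ i, 0 ≤ μ i)
    (hcert : ∀ φ : ℝ → ℂ, IsWeilTest φ → tsupport φ ⊆ Icc (-c) c → (∀ x, φ (-x) = (σ : ℂ) * φ x) →
      β * ∫ x, ‖φ x‖ ^ 2 ≤ (weilQuadratic φ).re + ∑ i, μ i * ‖∫ x, φ x * conj (v i x)‖ ^ 2)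
    (hPSD : ∀ α : Fin k → ℝ, 0 ≤ ∑ i, ∑ j, α i * α j *
      ((β - lam) * ((weilPoleForm₂ (v i) (v j) + weilDirichletEnergy₂ c (v i) (v j) -
          weilMarkovConstant c * ∫ x, (v i x * conj (v j x)).re) - lam * ∫ x, (v i x * conj (v j x)).re) -
        ∫ x, ((F i - ∑ l, W i l • v l) x * conj ((F j - ∑ l, W j l • v l) x)).re))
    {φ : ℝ → ℂ} (hφ : IsWeilTest φ) (hφs : tsupport φ ⊆ Icc (-c) c) (hφp : ∀ x, φ (-x) = (σ : ℂ) * φ x) :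
    lam * ∫ x, ‖φ x‖ ^ 2 ≤ (weilQuadratic φ).re := by
  have hveq : ∀ i, v i = fun x ↦ (((Icc (-c) c).indicator (g i) x : ℝ) : ℂ) := fun i ↦ funext (hv i)
  -- the trial vectors lie in the sector form domain
  have hvD : ∀ i, MemLp (v i) 2 ∧ (∀ x, x ∉ Icc (-c) c → v i x = 0) ∧ (∀ x, (v i x).im = 0) ∧
      (∀ x, v i (-x) = (σ : ℂ) * v i x) ∧
      IntegrableOn (fun t ↦ weilArchDensity t * weilIncrement (v i) t) (Ioi 0) := by
    intro i
    obtain ⟨h1, h2, h3, h4⟩ := dt_indicator_mul_mem_formDomain hc ((hg i).of_le (by norm_num))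
    refine ⟨by rw [hveq i]; exact h1, fun x hx ↦ by rw [hv i x]; exact h2 x hx,
      fun x ↦ by rw [hv i x]; exact h3 x, fun x ↦ ?_, by rw [hveq i]; exact h4⟩
    rw [hv i, hv i]
    have hsym : (-x ∈ Icc (-c) c) ↔ (x ∈ Icc (-c) c) := by
      simp only [mem_Icc]; constructor <;> rintro ⟨h₁, h₂⟩ <;> constructor <;> linarith
    by_cases hx : x ∈ Icc (-c) c
    · rw [indicator_of_mem (hsym.2 hx), indicator_of_mem hx, hgp i x]; push_cast; ring
    · rw [indicator_of_notMem (fun h ↦ hx (hsym.1 h)), indicator_of_notMem hx]; simp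
  -- majorants and window images
  have hmaj : ∀ i, ∃ m : ℝ → ℝ, MemLp m 2 volume ∧
      (∀ y ∈ Ioo (-c) c,
        IntegrableOn (fun t ↦ weilArchDensity t * ‖2 * v i y - v i (y - t) - v i (y + t)‖) (Ioi 0)) ∧
      (∀ y ∈ Ioo (-c) c,
        ∫ t in Ioi 0, weilArchDensity t * ‖2 * v i y - v i (y - t) - v i (y + t)‖ ≤ m y) :=
    fun i ↦ dt_exists_majorant_of_contDiff hc (hg i) (hv i)
  have hFm : ∀ i, MemLp (F i) 2 := by
    intro i
    obtain ⟨m, hm, _, hHm⟩ := hmaj i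
    exact dt_windowImage_memLp (hvD i).1 hm hHm (hF i)
  have hrepr : ∀ i (f : ℝ → ℂ), MemLp f 2 → (∀ x, x ∉ Icc (-c) c → f x = 0) → (∀ x, (f x).im = 0) →
      (∀ x, f (-x) = (σ : ℂ) * f x) →
      IntegrableOn (fun t ↦ weilArchDensity t * weilIncrement f t) (Ioi 0) →
      weilPoleForm₂ (v i) f + weilDirichletEnergy₂ c (v i) f -
          weilMarkovConstant c * ∫ x, (v i x * conj (f x)).re = ∫ x, (F i x * conj (f x)).re := by
    intro i f hf hfs _ _ _
    obtain ⟨m, hm, hHi, hHm⟩ := hmaj i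
    exact dt_windowImage_repr (hvD i).1 hm hHi hHm (hF i) hf hfs
  exact dt_sector_bound hc σ v F W μ hlam hμ hvD hFm hrepr hcert hPSD hφ hφs hφp

/-- **Deflated Temple (Lehmann–Maehly) lower bound for `ε_ev(c)` from even `C²` × indicator Ritz data.**
For `c > 0`, even `g_i ∈ C²(ℝ)`, `v_i = g_i 𝟙_{[-c,c]}`, window images `F_i` given by the explicit formula, any
residual coefficients `W`, a low-precision certificate `(β, μ)` on smooth even tests supported in `[-c, c]`,
`λ < β` and `(β − λ)(A − λG) − R ⪰ 0`: `λ ≤ weilEvenGroundEnergy c`.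
[cite: WeinsteinStenger1972, Ch. 5 §9 eq. (2) (k = 1: Temple's formula)] -/
theorem dt_weilEvenGroundEnergy_ge_of_ritz {c : ℝ} (hc : 0 < c) {k : ℕ}
    (g : Fin k → ℝ → ℝ) (hg : ∀ i, ContDiff ℝ 2 (g i)) (hge : ∀ i x, g i (-x) = g i x)
    (v F : Fin k → ℝ → ℂ) (hv : ∀ i x, v i x = (((Icc (-c) c).indicator (g i) x : ℝ) : ℂ))
    (hF : ∀ i y, F i y = (Icc (-c) c).indicator (fun y ↦
        2 * (∫ x, v i x * (Real.cosh (x / 2) : ℂ)) * (Real.cosh (y / 2) : ℂ) -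
          2 * (∫ x, v i x * (Real.sinh (x / 2) : ℂ)) * (Real.sinh (y / 2) : ℂ) +
        (∑ n ∈ weilPrimeIndex c, (((ArithmeticFunction.vonMangoldt n : ℝ) / Real.sqrt n : ℝ) : ℂ) *
          (2 * v i y - v i (y - Real.log n) - v i (y + Real.log n))) +
        ∫ t in Ioi 0, (weilArchDensity t : ℂ) * (2 * v i y - v i (y - t) - v i (y + t))) y -
      (weilMarkovConstant c : ℂ) * v i y)
    (W : Fin k → Fin k → ℝ) (μ : Fin k → ℝ) {β lam : ℝ} (hlam : lam < β) (hμ : ∀ i, 0 ≤ μ i)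
    (hcert : ∀ φ : ℝ → ℂ, IsWeilTest φ → tsupport φ ⊆ Icc (-c) c → (∀ x, φ (-x) = φ x) →
      β * ∫ x, ‖φ x‖ ^ 2 ≤ (weilQuadratic φ).re + ∑ i, μ i * ‖∫ x, φ x * conj (v i x)‖ ^ 2)
    (hPSD : ∀ α : Fin k → ℝ, 0 ≤ ∑ i, ∑ j, α i * α j *
      ((β - lam) * ((weilPoleForm₂ (v i) (v j) + weilDirichletEnergy₂ c (v i) (v j) -
          weilMarkovConstant c * ∫ x, (v i x * conj (v j x)).re) - lam * ∫ x, (v i x * conj (v j x)).re) -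
        ∫ x, ((F i - ∑ l, W i l • v l) x * conj ((F j - ∑ l, W j l • v l) x)).re)) :
    lam ≤ weilEvenGroundEnergy c := by
  refine le_weilEvenGroundEnergy_of_forall hc fun φ hφ hφs hφe hφn ↦ ?_
  have h := dt_sector_bound_of_ritz hc 1 g hg (fun i x ↦ by rw [hge i x]; ring) v F hv hF W μ
    hlam hμ (fun φ hφ hφs hφp ↦ hcert φ hφ hφs (fun x ↦ by simpa using hφp x)) hPSD hφ hφs
    (fun x ↦ by simpa using hφe x)
  rwa [hφn, mul_one] at h

/-- **Deflated Temple (Lehmann–Maehly) lower bound for `ε_od(c)` from odd `C²` × indicator Ritz data** — the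
L-side of the parity ladder's window cells (item 18085 / 18807): `λ ≤ weilOddGroundEnergy c`.
[cite: WeinsteinStenger1972, Ch. 5 §9 eq. (2) (k = 1: Temple's formula)] -/
theorem dt_weilOddGroundEnergy_ge_of_ritz {c : ℝ} (hc : 0 < c) {k : ℕ}
    (g : Fin k → ℝ → ℝ) (hg : ∀ i, ContDiff ℝ 2 (g i)) (hgo : ∀ i x, g i (-x) = -g i x)
    (v F : Fin k → ℝ → ℂ) (hv : ∀ i x, v i x = (((Icc (-c) c).indicator (g i) x : ℝ) : ℂ))
    (hF : ∀ i y, F i y = (Icc (-c) c).indicator (fun y ↦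
        2 * (∫ x, v i x * (Real.cosh (x / 2) : ℂ)) * (Real.cosh (y / 2) : ℂ) -
          2 * (∫ x, v i x * (Real.sinh (x / 2) : ℂ)) * (Real.sinh (y / 2) : ℂ) +
        (∑ n ∈ weilPrimeIndex c, (((ArithmeticFunction.vonMangoldt n : ℝ) / Real.sqrt n : ℝ) : ℂ) *
          (2 * v i y - v i (y - Real.log n) - v i (y + Real.log n))) +
        ∫ t in Ioi 0, (weilArchDensity t : ℂ) * (2 * v i y - v i (y - t) - v i (y + t))) y -
      (weilMarkovConstant c : ℂ) * v i y)
    (W : Fin k → Fin k → ℝ) (μ : Fin k → ℝ) {β lam : ℝ} (hlam : lam < β) (hμ : ∀ i, 0 ≤ μ i)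
    (hcert : ∀ φ : ℝ → ℂ, IsWeilTest φ → tsupport φ ⊆ Icc (-c) c → (∀ x, φ (-x) = -φ x) →
      β * ∫ x, ‖φ x‖ ^ 2 ≤ (weilQuadratic φ).re + ∑ i, μ i * ‖∫ x, φ x * conj (v i x)‖ ^ 2)
    (hPSD : ∀ α : Fin k → ℝ, 0 ≤ ∑ i, ∑ j, α i * α j *
      ((β - lam) * ((weilPoleForm₂ (v i) (v j) + weilDirichletEnergy₂ c (v i) (v j) -
          weilMarkovConstant c * ∫ x, (v i x * conj (v j x)).re) - lam * ∫ x, (v i x * conj (v j x)).re) -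
        ∫ x, ((F i - ∑ l, W i l • v l) x * conj ((F j - ∑ l, W j l • v l) x)).re)) :
    lam ≤ weilOddGroundEnergy c := by
  refine le_weilOddGroundEnergy_of_forall hc fun φ hφ hφs hφo hφn ↦ ?_
  have h := dt_sector_bound_of_ritz hc (-1) g hg (fun i x ↦ by rw [hgo i x]; ring) v F hv hF W μ
    hlam hμ (fun φ hφ hφs hφp ↦ hcert φ hφ hφs (fun x ↦ by simpa using hφp x)) hPSD hφ hφs
    (fun x ↦ by simpa using hφo x)
  rwa [hφn, mul_one] at h

end Summit.RiemannHypothesis.RiemannHypothesis.Theorems.EvenWinsBeyondArch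

end
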